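import Summits.AtomisticToContinuum.FouriersLaw.Theorems.OddSectorIrreversibilityOddDensityIsCorrectorGibbsIBP

/-!
# `OddDensityIsCorrector`, part 3b: the `μ_T`-adjoint of the generator is its momentum reversal

Helper file for support item `stmt-AtomisticToContinuum-9146`
(`OddSectorIrreversibility.OddDensityIsCorrector`).

Generalised detailed balance at the level of the generator (Kundu–Dhar–Narayan eq. (reln2),
`L† = Θ L Θ`): for the equilibrium generator `L = L_{T,T}` of an oscillator chain with `C¹`
potentials, the Gibbs density `ρ_T = e^{-H/T}` (`T ≠ 0`), the momentum reversal `Θ(q,p) = (q,-p)`,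
a test function `F ∈ C²_c` and any `k ∈ C²`,

  `∫ (L F) k ρ_T dx = ∫ F · (L (k∘Θ))∘Θ · ρ_T dx`        (`integral_generator_mul_eq_reversal`)

i.e. the formal `L²(μ_T)`-adjoint of `L` is `k ↦ (L(k∘Θ))∘Θ`: the Liouville part is
antisymmetric and odd under `Θ`, each bath term is symmetric and even (bilinear integrations by
parts of the previous file; the coordinate derivatives of `k∘Θ`, `partialQ_comp_reversal`,
`partialP_comp_reversal`, and `generator_comp_reversal`). Nothing here closes an item.
-/

noncomputable section

open MeasureTheory Filter Topology Set Function
open scoped ContDiff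
open Literature.MathematicalPhysics.KineticTheory.HeatConduction

namespace Summit.AtomisticToContinuum.FouriersLaw.Theorems.OddSectorIrreversibility

variable {N : ℕ}

/-! ### Coordinate derivatives of `k ∘ Θ` -/

/-- `∂_{q_i}(k∘Θ)(x) = (∂_{q_i} k)(Θx)` (`Θ` does not touch the positions). [folklore] -/
theorem partialQ_comp_reversal (i : Fin N) (k : PhaseSpace N → ℝ) (x : PhaseSpace N) :
    partialQ i (fun y : PhaseSpace N => k (y.1, -y.2)) x = partialQ i k (x.1, -x.2) := rfl

/-- `-(p[i ↦ t]) = (-p)[i ↦ -t]`. [folklore] -/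
theorem neg_update (p : Fin N → ℝ) (i : Fin N) (t : ℝ) :
    -Function.update p i t = Function.update (-p) i (-t) := by
  funext j
  by_cases hj : j = i
  · subst hj; simp
  · simp [hj]

/-- `∂_{p_i}(k∘Θ)(x) = -(∂_{p_i} k)(Θx)` (chain rule along `t ↦ -t`). [folklore] -/
theorem partialP_comp_reversal (i : Fin N) (k : PhaseSpace N → ℝ) (x : PhaseSpace N) :
    partialP i (fun y : PhaseSpace N => k (y.1, -y.2)) x = -partialP i k (x.1, -x.2) := by
  unfold partialP
  set g : ℝ → ℝ := fun s => k (x.1, Function.update (-x.2) i s) with hg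
  have h : (fun t : ℝ => k (x.1, -Function.update x.2 i t)) = fun t => g (-t) := by
    funext t; simp only [hg, neg_update]
  rw [h, deriv_comp_neg]
  rfl

/-- `∂_{p_i}(-f) = -∂_{p_i} f`. [folklore] -/
theorem partialP_neg (i : Fin N) (f : PhaseSpace N → ℝ) (x : PhaseSpace N) :
    partialP i (fun z => -f z) x = -partialP i f x := by
  unfold partialP
  exact deriv.neg

/-- `∂²_{p_i}(k∘Θ)(x) = (∂²_{p_i} k)(Θx)`. [folklore] -/
theorem partialP_partialP_comp_reversal (i : Fin N) (k : PhaseSpace N → ℝ) (x : PhaseSpace N) :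
    partialP i (partialP i (fun y : PhaseSpace N => k (y.1, -y.2))) x =
      partialP i (partialP i k) (x.1, -x.2) := by
  have h : partialP i (fun y : PhaseSpace N => k (y.1, -y.2)) =
      fun y : PhaseSpace N => (fun z => -partialP i k z) (y.1, -y.2) :=
    funext fun y => partialP_comp_reversal i k y
  rw [h, partialP_comp_reversal i (fun z => -partialP i k z) x, partialP_neg, neg_neg]

/-- `∂_{q_i} H (Θx) = ∂_{q_i} H (x)` (the force depends on the positions only). [folklore] -/
theorem partialQ_hamiltonian_reversal (P : OscillatorChain) (i : Fin N) (x : PhaseSpace N) :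
    partialQ i (P.hamiltonian N) (x.1, -x.2) = partialQ i (P.hamiltonian N) x := by
  rw [P.partialQ_hamiltonian_eq, P.partialQ_hamiltonian_eq]

/-- **The generator of `k∘Θ`, read at `Θx`**:
`(L_{T_L,T_R}(k∘Θ))(Θx) = ∑_i (-p_i ∂_{q_i}k + ∂_{q_i}H ∂_{p_i}k)(x)
  + γ ∑_i ([i=0](T_L ∂²_{p_i}k - p_i∂_{p_i}k) + [i=N-1](T_R ∂²_{p_i}k - p_i∂_{p_i}k))(x)` — the
Liouville part flips its sign, the bath part is unchanged. [cite: KunduDharNarayan2009, eq. (reln2)] -/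
theorem generator_comp_reversal (P : OscillatorChain) (N : ℕ) (T_L T_R : ℝ) (k : PhaseSpace N → ℝ)
    (x : PhaseSpace N) :
    P.generator N T_L T_R (fun y : PhaseSpace N => k (y.1, -y.2)) (x.1, -x.2) =
      (∑ i : Fin N, (-(x.2 i) * partialQ i k x + partialQ i (P.hamiltonian N) x * partialP i k x)) +
        P.γ * ∑ i : Fin N,
          ((if i.val = 0 then T_L * partialP i (partialP i k) x - x.2 i * partialP i k x else 0) +
            (if i.val = N - 1 then T_R * partialP i (partialP i k) x - x.2 i * partialP i k x else 0)) := by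
  unfold OscillatorChain.generator
  have e1 : ∀ i : Fin N, partialQ i (fun y : PhaseSpace N => k (y.1, -y.2)) (x.1, -x.2) = partialQ i k x :=
    fun i => by rw [partialQ_comp_reversal]; simp
  have e2 : ∀ i : Fin N, partialP i (fun y : PhaseSpace N => k (y.1, -y.2)) (x.1, -x.2) = -partialP i k x :=
    fun i => by rw [partialP_comp_reversal]; simp
  have e3 : ∀ i : Fin N, partialP i (partialP i (fun y : PhaseSpace N => k (y.1, -y.2))) (x.1, -x.2) =
      partialP i (partialP i k) x := fun i => by rw [partialP_partialP_comp_reversal]; simp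
  have e4 : ∀ i : Fin N, partialQ i (P.hamiltonian N) (x.1, -x.2) = partialQ i (P.hamiltonian N) x :=
    fun i => partialQ_hamiltonian_reversal P i x
  simp only [e1, e2, e3, e4, Pi.neg_apply]
  congr 1
  · exact Finset.sum_congr rfl fun i _ => by ring
  · congr 1
    refine Finset.sum_congr rfl fun i _ => ?_
    split_ifs <;> ring

/-! ### The adjoint identity -/

section Adjoint

variable (P : OscillatorChain) (hU : ContDiff ℝ 1 P.U) (hV : ContDiff ℝ 1 P.V) (N : ℕ) (T : ℝ)
include hU hV

/-- **`L† = Θ L Θ` at the level of the equilibrium generator** (generalised detailed balance,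
Kundu–Dhar–Narayan (reln2)): for `F ∈ C²_c` and `k ∈ C²`,
`∫ (L_{T,T} F) k e^{-H/T} dx = ∫ F · (L_{T,T}(k∘Θ))∘Θ · e^{-H/T} dx`, `Θ(q,p) = (q,-p)`.
[cite: KunduDharNarayan2009, eq. (reln2)] [cite: MaesNetocny2010, §3] -/
theorem integral_generator_mul_eq_reversal (hT : T ≠ 0) {F k : PhaseSpace N → ℝ} (hF : ContDiff ℝ 2 F)
    (hFc : HasCompactSupport F) (hk : ContDiff ℝ 2 k) :
    ∫ x, P.generator N T T F x * k x * P.gibbsDensity N T x =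
      ∫ x, F x * P.generator N T T (fun y : PhaseSpace N => k (y.1, -y.2)) (x.1, -x.2) *
        P.gibbsDensity N T x := by
  have hF1 : ContDiff ℝ 1 F := hF.of_le (by norm_num)
  have hk1 : ContDiff ℝ 1 k := hk.of_le (by norm_num)
  have hFd : Differentiable ℝ F := hF.differentiable two_ne_zero
  have hkd : Differentiable ℝ k := hk.differentiable two_ne_zero
  have hH1 : ContDiff ℝ 1 (P.hamiltonian N) := P.contDiff_hamiltonian hU hV N
  have hρc : Continuous (P.gibbsDensity N T) := P.continuous_gibbsDensity hU.continuous hV.continuous N T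
  have hpc : ∀ i, Continuous fun x : PhaseSpace N => x.2 i := fun i => (continuous_apply i).comp continuous_snd
  have hWc : ∀ i, Continuous (partialQ i (P.hamiltonian N)) := fun i => P.continuous_partialQ_hamiltonian hH1 i
  -- continuity / compact support of the pieces
  have hQc : ∀ i, Continuous (partialQ i F) := fun i => continuous_partialQ hF two_ne_zero i
  have hPc : ∀ i, Continuous (partialP i F) := fun i => continuous_partialP hF two_ne_zero i
  have hP1 : ∀ i, ContDiff ℝ 1 (partialP i F) := fun i => contDiff_partialP hF (by norm_num) i
  have hPPc : ∀ i, Continuous (partialP i (partialP i F)) := fun i =>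
    continuous_partialP (hP1 i) one_ne_zero i
  have hQs : ∀ i, HasCompactSupport (partialQ i F) := fun i => hasCompactSupport_partialQ hFd hFc i
  have hPs : ∀ i, HasCompactSupport (partialP i F) := fun i => hasCompactSupport_partialP hFd hFc i
  have hPPs : ∀ i, HasCompactSupport (partialP i (partialP i F)) := fun i =>
    hasCompactSupport_partialP ((hP1 i).differentiable one_ne_zero) (hPs i) i
  have hQkc : ∀ i, Continuous (partialQ i k) := fun i => continuous_partialQ hk two_ne_zero i
  have hPkc : ∀ i, Continuous (partialP i k) := fun i => continuous_partialP hk two_ne_zero i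
  have hPk1 : ∀ i, ContDiff ℝ 1 (partialP i k) := fun i => contDiff_partialP hk (by norm_num) i
  have hPPkc : ∀ i, Continuous (partialP i (partialP i k)) := fun i =>
    continuous_partialP (hPk1 i) one_ne_zero i
  -- rewrite the right-hand side through `generator_comp_reversal`
  simp_rw [generator_comp_reversal P N T T k]
  -- integrability of every term
  have intA : ∀ i, Integrable (fun x => (x.2 i * partialQ i F x -
      partialQ i (P.hamiltonian N) x * partialP i F x) * k x * P.gibbsDensity N T x) := by
    intro i
    refine Continuous.integrable_of_hasCompactSupport (by fun_prop) ?_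
    exact ((((hQs i).mul_left (f := fun x : PhaseSpace N => x.2 i)).sub ((hPs i).mul_left)).mul_right).mul_right
  have intB : ∀ (i : Fin N) (c : Prop) [Decidable c], Integrable (fun x =>
      (if c then T * partialP i (partialP i F) x - x.2 i * partialP i F x else 0) * k x *
        P.gibbsDensity N T x) := by
    intro i c _
    by_cases hc : c
    · simp only [hc, if_true]
      refine Continuous.integrable_of_hasCompactSupport (by fun_prop) ?_
      exact ((((hPPs i).mul_left).sub ((hPs i).mul_left)).mul_right).mul_right
    · simp only [hc, if_false, zero_mul]
      exact integrable_zero _ _ _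
  have intA' : ∀ i, Integrable (fun x => F x * (-(x.2 i) * partialQ i k x +
      partialQ i (P.hamiltonian N) x * partialP i k x) * P.gibbsDensity N T x) := by
    intro i
    refine Continuous.integrable_of_hasCompactSupport (by fun_prop) ?_
    exact hFc.mul_right.mul_right
  have intB' : ∀ (i : Fin N) (c : Prop) [Decidable c], Integrable (fun x =>
      F x * (if c then T * partialP i (partialP i k) x - x.2 i * partialP i k x else 0) *
        P.gibbsDensity N T x) := by
    intro i c _
    by_cases hc : c
    · simp only [hc, if_true]
      refine Continuous.integrable_of_hasCompactSupport (by fun_prop) ?_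
      exact hFc.mul_right.mul_right
    · simp only [hc, if_false, mul_zero, zero_mul]
      exact integrable_zero _ _ _
  -- expand both sides into sums of integrals
  have hLHS : ∀ x, P.generator N T T F x * k x * P.gibbsDensity N T x =
      (∑ i, (x.2 i * partialQ i F x - partialQ i (P.hamiltonian N) x * partialP i F x) * k x *
        P.gibbsDensity N T x) +
      P.γ * ∑ i, ((if i.val = 0 then T * partialP i (partialP i F) x - x.2 i * partialP i F x else 0) *
          k x * P.gibbsDensity N T x +
        (if i.val = N - 1 then T * partialP i (partialP i F) x - x.2 i * partialP i F x else 0) *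
          k x * P.gibbsDensity N T x) := by
    intro x
    simp only [OscillatorChain.generator, Finset.sum_mul, Finset.mul_sum, add_mul]
    congr 1
    exact Finset.sum_congr rfl fun i _ => by ring
  have hRHS : ∀ x, F x * ((∑ i, (-(x.2 i) * partialQ i k x + partialQ i (P.hamiltonian N) x * partialP i k x)) +
      P.γ * ∑ i, ((if i.val = 0 then T * partialP i (partialP i k) x - x.2 i * partialP i k x else 0) +
        (if i.val = N - 1 then T * partialP i (partialP i k) x - x.2 i * partialP i k x else 0))) *
      P.gibbsDensity N T x =
      (∑ i, F x * (-(x.2 i) * partialQ i k x + partialQ i (P.hamiltonian N) x * partialP i k x) *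
        P.gibbsDensity N T x) +
      P.γ * ∑ i, (F x * (if i.val = 0 then T * partialP i (partialP i k) x - x.2 i * partialP i k x else 0) *
          P.gibbsDensity N T x +
        F x * (if i.val = N - 1 then T * partialP i (partialP i k) x - x.2 i * partialP i k x else 0) *
          P.gibbsDensity N T x) := by
    intro x
    simp only [Finset.sum_mul, Finset.mul_sum, add_mul, mul_add]
    congr 1
    exact Finset.sum_congr rfl fun i _ => by ring
  simp_rw [hLHS, hRHS]
  have intBC : ∀ i : Fin N, Integrable (fun x =>
      (if i.val = 0 then T * partialP i (partialP i F) x - x.2 i * partialP i F x else 0) * k x *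
          P.gibbsDensity N T x +
        (if i.val = N - 1 then T * partialP i (partialP i F) x - x.2 i * partialP i F x else 0) * k x *
          P.gibbsDensity N T x) := fun i => (intB i _).add (intB i _)
  have intBC' : ∀ i : Fin N, Integrable (fun x =>
      F x * (if i.val = 0 then T * partialP i (partialP i k) x - x.2 i * partialP i k x else 0) *
          P.gibbsDensity N T x +
        F x * (if i.val = N - 1 then T * partialP i (partialP i k) x - x.2 i * partialP i k x else 0) *
          P.gibbsDensity N T x) := fun i => (intB' i _).add (intB' i _)
  rw [integral_add (integrable_finsetSum _ fun i _ => intA i)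
      ((integrable_finsetSum _ fun i _ => intBC i).const_mul _),
    integral_add (integrable_finsetSum _ fun i _ => intA' i)
      ((integrable_finsetSum _ fun i _ => intBC' i).const_mul _),
    integral_finsetSum _ (fun i _ => intA i), integral_finsetSum _ (fun i _ => intA' i),
    integral_const_mul, integral_const_mul,
    integral_finsetSum _ (fun i _ => intBC i), integral_finsetSum _ (fun i _ => intBC' i)]
  congr 1
  · exact Finset.sum_congr rfl fun i _ => integral_liouville_mul_mul_gibbsDensity P hU hV N T hF1 hFc hk1 i
  · congr 1
    refine Finset.sum_congr rfl fun i _ => ?_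
    rw [integral_add (intB i _) (intB i _), integral_add (intB' i _) (intB' i _)]
    congr 1
    · by_cases h0 : i.val = 0
      · simp only [h0, if_true]
        exact integral_bath_mul_mul_gibbsDensity P hU hV N T hT hF hFc hk i
      · simp only [h0, if_false, zero_mul, mul_zero, integral_zero]
    · by_cases h0 : i.val = N - 1
      · simp only [h0, if_true]
        exact integral_bath_mul_mul_gibbsDensity P hU hV N T hT hF hFc hk i
      · simp only [h0, if_false, zero_mul, mul_zero, integral_zero]

end Adjoint

/-- **The `L²(μ_T)`-adjoint of the equilibrium generator, Gibbs-measure form.** For the pinned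
anharmonic chain (`ω₂ > 0`, `lam, β ≥ 0`, any `γ`, `T > 0`), `F ∈ C²_c` and `k ∈ C²` with `F·(L(k∘Θ))∘Θ`
and `(LF)·k` integrable for `μ_T` automatically (compact support of `F`):
`∫ (L F) k dμ_T = ∫ F · (L(k∘Θ))∘Θ dμ_T`. [cite: KunduDharNarayan2009, eq. (reln2)] -/
theorem pinnedChain_integral_generator_mul_gibbsMeasure_eq_reversal (ω₂ lam β γ : ℝ) (N : ℕ) {T : ℝ}
    (hT : T ≠ 0) {F k : PhaseSpace N → ℝ} (hF : ContDiff ℝ 2 F) (hFc : HasCompactSupport F)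
    (hk : ContDiff ℝ 2 k) :
    ∫ x, (pinnedChain ω₂ lam β γ).generator N T T F x * k x ∂((pinnedChain ω₂ lam β γ).gibbsMeasure N T) =
      ∫ x, F x * (pinnedChain ω₂ lam β γ).generator N T T (fun y : PhaseSpace N => k (y.1, -y.2)) (x.1, -x.2)
        ∂((pinnedChain ω₂ lam β γ).gibbsMeasure N T) := by
  rw [(pinnedChain ω₂ lam β γ).integral_gibbsMeasure, (pinnedChain ω₂ lam β γ).integral_gibbsMeasure,
    integral_generator_mul_eq_reversal (pinnedChain ω₂ lam β γ) (pinnedChain_contDiff_U ω₂ lam β γ)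
      (pinnedChain_contDiff_V ω₂ lam β γ) N T hT hF hFc hk]

end Summit.AtomisticToContinuum.FouriersLaw.Theorems.OddSectorIrreversibility

end
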